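import Literature.AlgebraicGeometry.Shioda1982.ExceptionalQuadruplesComplete
import HarnessLib

/-!
# Shioda 1982 / Meyer–Neutsch 1981: no exceptional quadruple is missing at ANY level `2 ≤ N ≤ 60` (kernel sweep)

Topic `Literature/AlgebraicGeometry/Shioda1982`; companion of `ExceptionalQuadruplesComplete.lean` (search procedure `checkB`, soundness
theorem `tabelleOneCompleteAt_of_chunks`, invariant form `exists_mem_reps_of_isExceptionalQuadruple`; see its module docstring for
sources, method and framing). That file and its companions certify completeness of [MeyerNeutsch1981Fermatquadrupel, Tabelle 1] AT
ITS OWN 22 levels. This file runs the same kernel search at EVERY level `2 ≤ N ≤ 60` — in five separate kernel evaluations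
(`checkB'_range_a … _e`, ≈ 10⁵ candidate triples in all) — and concludes:
* `tabelleOneCompleteAt_of_le_sixty` — `TabelleOneCompleteAt N` for every `2 ≤ N ≤ 60`;
* `not_isExceptionalQuadruple_of_le_sixty` — **for `2 ≤ N ≤ 60` off the table (`tabelleOne N = []`, i.e. the 45 levels
  `N ≠ 12, 14, 15, 18, 20, 21, 24, 28, 30, 36, 40, 42, 48, 60`) there is NO exceptional quadruple at all**: every Hodge class of the
  Fermat surface `X²_N` without a pair and with `gcd = 1` is standard — the zeros of Shioda's count in this range
  ([Shioda1982PicardFermat, table p. 727] lists exactly the `m` with a non-zero count; [MeyerNeutsch1981Fermatquadrupel, Tabelle 1]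
  has no row at these `N`).
One definition (`checkB'`, the search without its `NeZero` instance argument, so that a range of levels is one decidable
statement); no named fact. The range stops at `60` only to bound kernel time (≈ 3 min for this file); the levels `61 ≤ N ≤ 180` off
the table are not swept here, and `N > 180` is [Aoki1983, Thm. C] (printed theorem, not vendored). Second implementation: the
plain-Python enumeration `code/complete_check.py` of cell `pub-hfermat` (0 exceptional multisets at every `N ≤ 60` off the table).

HONEST FRAMING (cell `pub-hfermat`): explicit algebraic cycles for specific Hodge classes on Fermat/Delsarte varieties; residual open
instances listed; no claim on general Hodge.

## References
* [MeyerNeutsch1981Fermatquadrupel] W. Meyer, W. Neutsch, *Fermatquadrupel*, Math. Ann. 256 (1981) 51–62, §2 p. 53, Tabelle 1 p. 54.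
* [Shioda1982PicardFermat] T. Shioda, J. Fac. Sci. Univ. Tokyo IA 28 (1982) 725–734, table p. 727.
* [Aoki1983] N. Aoki, Math. Ann. 266 (1983) 23–54, Thm. C.
-/

namespace Literature.AlgebraicGeometry.Shioda1982

open Literature.AlgebraicGeometry.HodgeTheory

/-- The search `checkB N 0 N` over all first entries, without the `NeZero N` instance argument (vacuously `true` at `N = 0`), so
that "`∀ N` in a range" is a single decidable statement. [folklore] -/
def checkB' (N : ℕ) : Bool := if h : N = 0 then true else @checkB N ⟨h⟩ 0 N

/-- `checkB'` is `checkB N 0 N` for `N ≠ 0`. [folklore] -/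
theorem checkB'_eq (N : ℕ) [NeZero N] : checkB' N = checkB N 0 N := by
  unfold checkB'
  rw [dif_neg (NeZero.ne N)]

set_option maxHeartbeats 0 in
/-- The search passes at every level `2 ≤ N ≤ 40`. Kernel evaluation. [cite: MeyerNeutsch1981Fermatquadrupel, §2 p. 53 and Tabelle 1 p. 54 (rows N ≤ 40)] -/
theorem checkB'_range_a : ∀ N ∈ List.range' 2 39, checkB' N = true := by
  decide +kernel

set_option maxHeartbeats 0 in
/-- The search passes at every level `41 ≤ N ≤ 48`. Kernel evaluation. [cite: MeyerNeutsch1981Fermatquadrupel, Tabelle 1 p. 54 (rows 42, 48)] -/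
theorem checkB'_range_b : ∀ N ∈ List.range' 41 8, checkB' N = true := by
  decide +kernel

set_option maxHeartbeats 0 in
/-- The search passes at every level `49 ≤ N ≤ 54`. Kernel evaluation. [cite: MeyerNeutsch1981Fermatquadrupel, Tabelle 1 p. 54 (no row)] -/
theorem checkB'_range_c : ∀ N ∈ List.range' 49 6, checkB' N = true := by
  decide +kernel

set_option maxHeartbeats 0 in
/-- The search passes at every level `55 ≤ N ≤ 58`. Kernel evaluation. [cite: MeyerNeutsch1981Fermatquadrupel, Tabelle 1 p. 54 (no row)] -/
theorem checkB'_range_d : ∀ N ∈ List.range' 55 4, checkB' N = true := by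
  decide +kernel

set_option maxHeartbeats 0 in
/-- The search passes at the levels `59, 60`. Kernel evaluation. [cite: MeyerNeutsch1981Fermatquadrupel, Tabelle 1 p. 54 (row 60)] -/
theorem checkB'_range_e : ∀ N ∈ List.range' 59 2, checkB' N = true := by
  decide +kernel

/-- The search passes at every level `2 ≤ N ≤ 60`. [cite: MeyerNeutsch1981Fermatquadrupel, §2 p. 53] -/
theorem checkB'_of_le_sixty (N : ℕ) (h2 : 2 ≤ N) (h60 : N ≤ 60) : checkB' N = true := by
  rcases Nat.lt_or_ge N 41 with hA | hA
  · exact checkB'_range_a N (List.mem_range'_1.mpr ⟨h2, by omega⟩)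
  rcases Nat.lt_or_ge N 49 with hB | hB
  · exact checkB'_range_b N (List.mem_range'_1.mpr ⟨hA, by omega⟩)
  rcases Nat.lt_or_ge N 55 with hC | hC
  · exact checkB'_range_c N (List.mem_range'_1.mpr ⟨hB, by omega⟩)
  rcases Nat.lt_or_ge N 59 with hD | hD
  · exact checkB'_range_d N (List.mem_range'_1.mpr ⟨hC, by omega⟩)
  · exact checkB'_range_e N (List.mem_range'_1.mpr ⟨hD, by omega⟩)

/-- **Uniform completeness for all `2 ≤ N ≤ 60`:** every sorted Hodge 4-multiset mod `N` without a pair and with `gcd = 1` is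
standard or a unit multiple of a representative printed in Tabelle 1 at level `N` (none printed at 45 of these levels).
[cite: MeyerNeutsch1981Fermatquadrupel, §2 p. 53 and Tabelle 1 p. 54] [cite: Shioda1982PicardFermat, table p. 727] -/
theorem tabelleOneCompleteAt_of_le_sixty (N : ℕ) [NeZero N] (h2 : 2 ≤ N) (h60 : N ≤ 60) : TabelleOneCompleteAt N := by
  refine tabelleOneCompleteAt_of_chunks N [(0, N)]
    (fun a ha ↦ ⟨(0, N), List.mem_singleton.mpr rfl, Nat.zero_le a, by simpa using ha⟩) ?_
  intro p hp
  rw [List.mem_singleton] at hp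
  subst hp
  rw [← checkB'_eq]
  exact checkB'_of_le_sixty N h2 h60

/-- **No exceptional quadruple at the levels `2 ≤ N ≤ 60` absent from Tabelle 1** (`tabelleOne N = []`): every Hodge class of
the Fermat surface `X²_N` (up to permutation) without a pair and with `gcd = 1` is standard there — the zeros of Shioda's table in
this range, kernel-checked. [cite: Shioda1982PicardFermat, table p. 727] [cite: MeyerNeutsch1981Fermatquadrupel, Tabelle 1 p. 54] -/
theorem not_isExceptionalQuadruple_of_le_sixty (N : ℕ) [NeZero N] (h2 : 2 ≤ N) (h60 : N ≤ 60) (htab : tabelleOne N = [])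
    (s : Multiset (ZMod N)) : ¬ IsExceptionalQuadruple N s := by
  intro hs
  obtain ⟨r, hr, -⟩ := exists_mem_reps_of_isExceptionalQuadruple (tabelleOneCompleteAt_of_le_sixty N h2 h60) hs
  simp [reps, htab] at hr

/-- Instance: the Fermat surface of degree `16` (a level off the table, between the exceptional levels `15` and `18`) has no
exceptional Hodge class. [cite: Shioda1982PicardFermat, table p. 727 (m = 16 absent)] -/
theorem not_isExceptionalQuadruple_sixteen (s : Multiset (ZMod 16)) : ¬ IsExceptionalQuadruple 16 s :=
  not_isExceptionalQuadruple_of_le_sixty 16 (by norm_num) (by norm_num) rfl s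

end Literature.AlgebraicGeometry.Shioda1982
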